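import Mathlib.NumberTheory.DirichletCharacter.Bounds
import Mathlib.Analysis.SpecificLimits.Normed
import Literature.NumberTheory.GaloisRepresentations.ArtinLFunctionRatLSeriesProofs
import Literature.NumberTheory.GaloisRepresentations.ArtinEulerProductProofs
import Literature.NumberTheory.GaloisRepresentations.FramedRepTwistEulerFactorProofs
import HarnessLib

/-!
# Dirichlet coefficients of Artin L-functions over `ℚ`: local Euler factors and character twists
(pure proofs; companion to `Literature.NumberTheory.GaloisRepresentations.ArtinLFunctionRatLSeriesProofs`)

A. R. Booker, *Poles of Artin L-functions and the strong Artin conjecture*, Ann. of Math. 158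
(2003), proof of Lemma 1, p. 1093: "Finally `∑_{(r,p)=1} a_r χ(r) r^{-s}` is `L(s, ρ ⊗ χ₀ ⊗ χ)`,
with the Euler factor at `p` removed.  That factor and the terms involving `a_{p^k}` and `E_p(s)`
amount to polynomials in `p^{-s}`."  This file proves the form of that sentence consumed by the
analytic half of Lemma 1 (the algebraic half, `LSeries.exists_addTwist_eq_sum_charTwist` of
`LFunctions/AdditiveTwistProofs`, produces NAIVE character twists `∑ a(n) χ(n) n^{-s}` by Dirichlet
characters `χ` of arbitrary level):

* `ArtinRep.exists_LSeries_eq_artinLFunction_local` — the Dirichlet coefficients `a` of `L(s, ρ)`,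
  `ρ : Γ_ℚ → GL(V)`, `dim V ≤ 2` (the multiplicative, divisor-bounded sequence of
  `ArtinRep.exists_LSeries_eq_artinLFunction_of_finrank_le_two`, whose construction is re-run here)
  **together with their local generating series**: for every prime `p` and `|z| < 1`,
  `∑_k a(p^k) z^k = 1 / L_p(ρ, z)` (`L_p = ArtinRep.eulerFactorAt` at the place over `p`);
* `FramedArtinRep.hasSum_coeff_prime_pow` — the same for ANY `a` with `∑ a(n) n^{-s} = L(s, σ)` on
  `Re s > 1`, `σ : Γ_ℚ → GL₂(ℂ)` (injectivity of Dirichlet series, as in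
  `ArtinRep.eq_of_LSeries_eq_artinLFunction_of_finrank_le_two`);
* `FramedArtinRep.exists_entire_LSeries_mul_dirichlet_eq` (**main**) — for a Dirichlet character
  `ε` mod `N` (any level, possibly imprimitive or trivial) and a twist `π` of `σ` by the Galois
  character of `ε` (`π(g) = ε(χ_N(g)) · σ(g)`, `dirichletGaloisCharacter`,
  `FramedRep.exists_twist`), there is an ENTIRE function `C` — the finite product
  `C(s) = ∏_{p ∣ N} L_p(π, p^{-s})` of the Euler factors of `π` at the primes dividing `N` — with
  `∑ a(n) ε(n) n^{-s} = C(s) · L(s, π)` for `Re s > 1` and every coefficient sequence `a` of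
  `L(s, σ)`.  Proof: the Euler product of the multiplicative sequence `a · ε` (Mathlib
  `EulerProduct.eulerProduct_hasProd`) has local factors `∑_k a(p^k) ε(p)^k p^{-ks} =
  1 / L_p(σ, ε(p) p^{-s})`, which is `1 / L_p(π, p^{-s})` for `p ∤ N`
  (`FramedRep.eval_eulerFactorAt_of_twist_dirichlet`) and `1` for `p ∣ N` (`ε(p) = 0`); compare
  with the Euler product of `π` (`artinLFunction_eulerProduct_holds`) off the finitely many `p ∣ N`.

No definition, no named fact (D-0026); theorems only.

## References

* A. R. Booker, Ann. of Math. (2) 158 (2003), 1089–1098: proof of Lemma 1, p. 1093. [Booker2003]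
* P. Deligne, J.-P. Serre, *Formes modulaires de poids 1*, Ann. Sci. ÉNS (4) 7 (1974), §9, proof of
  Thm. 9.1 (coefficients of a degree-two Euler product). [DeligneSerreASENS1974]
* F. Diamond, J. Shurman, *A First Course in Modular Forms* (2005), Thm. 5.9.2 and its proof,
  (5.24)–(5.26). [DiamondShurman2005]

## Mathlib / tree search

`lean search 'hasSum_coeff_prime_pow|LSeries_mul_dirichlet|exists_entire_LSeries_mul'`: nothing.
Tree: `ArtinRep.exists_LSeries_eq_artinLFunction_of_finrank_le_two` (local structure not exposed),
`eulerCoeffTwo`, `multiplicativeExtension`, `lseriesSummable_of_norm_le_card_divisors`,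
`artinLFunction_eulerProduct_holds`, `ArtinRep.eval_eulerFactorAt_ne_zero`.  Mathlib:
`EulerProduct.eulerProduct_hasProd`, `LSeries.eq_of_LSeries_eventually_eq`,
`DirichletCharacter.norm_le_one`, `summable_pow_mul_geometric_of_norm_lt_one`.
-/

noncomputable section

open scoped NumberField
open Field IsDedekindDomain Module NumberField Polynomial Complex Filter

namespace Literature.NumberTheory.GaloisRepresentations

open Rat.HeightOneSpectrum

/-! ### Power series of degree-two Euler factors -/

/-- `(∑_r c_r x^r)(1 - a x + b x²) = 1` for `c₀ = 1`, `c₁ = a`, `c_{r+2} = a c_{r+1} - b c_r`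
(the tree's `ModularForms.tsum_mul_eq_one_of_recurrence`, re-proved privately as in
`ArtinLFunctionRatLSeriesProofs`). [cite: DiamondShurman2005, proof of Thm. 5.9.2, (5.24)] -/
private theorem tsum_mul_eq_one_of_recurrence'' {a b x : ℂ} {c : ℕ → ℂ} (h0 : c 0 = 1)
    (h1 : c 1 = a) (hrec : ∀ r, c (r + 2) = a * c (r + 1) - b * c r)
    (hs : Summable fun r ↦ c r * x ^ r) :
    (∑' r, c r * x ^ r) * (1 - a * x + b * x ^ 2) = 1 := by
  set u : ℕ → ℂ := fun r ↦ c r * x ^ r with hu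
  have hs1 : Summable fun r ↦ u (r + 1) := (summable_nat_add_iff 1).mpr hs
  have e0 : ∑' r, u r = 1 + ∑' r, u (r + 1) := by
    rw [hs.tsum_eq_zero_add]
    simp [hu, h0]
  have e1 : ∑' r, u (r + 1) = a * x + ∑' r, u (r + 2) := by
    rw [hs1.tsum_eq_zero_add]
    simp [hu, h1]
  have e2 : ∑' r, u (r + 2) = a * x * ∑' r, u (r + 1) - b * x ^ 2 * ∑' r, u r := by
    rw [← tsum_mul_left, ← tsum_mul_left, ← (hs1.mul_left _).tsum_sub (hs.mul_left _)]
    refine tsum_congr fun r ↦ ?_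
    simp only [hu, hrec]
    ring
  change (∑' r, u r) * _ = 1
  linear_combination (1 - a * x) * e0 + e1 + e2

/-- **`∑_k h_k(λ, μ) z^k = 1/((1 - λz)(1 - μz))` on the unit disc** for `|λ|, |μ| ≤ 1`: the
series converges absolutely for `|z| < 1` (`|h_k| ≤ k + 1`, `norm_eulerCoeffTwo_le`) and satisfies
`(∑ h_k z^k)(1 - (λ+μ) z + λμ z²) = 1` (recursion `eulerCoeffTwo_add_two`).
[cite: DeligneSerreASENS1974, §9 proof of Thm. 9.1] -/
theorem hasSum_eulerCoeffTwo_mul_pow {l m z : ℂ} (hl : ‖l‖ ≤ 1) (hm : ‖m‖ ≤ 1) (hz : ‖z‖ < 1) :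
    HasSum (fun k : ℕ => eulerCoeffTwo l m k * z ^ k) ((1 - l * z) * (1 - m * z))⁻¹ := by
  have hsum : Summable fun k : ℕ => eulerCoeffTwo l m k * z ^ k := by
    have hg1 : Summable fun k : ℕ => ((k : ℝ) ^ 1 * ‖z‖ ^ k : ℝ) :=
      summable_pow_mul_geometric_of_norm_lt_one 1 (by rwa [norm_norm])
    have hg0 : Summable fun k : ℕ => (‖z‖ ^ k : ℝ) :=
      summable_geometric_of_lt_one (norm_nonneg _) hz
    refine Summable.of_norm_bounded (g := fun k : ℕ => ((k : ℝ) ^ 1 * ‖z‖ ^ k + ‖z‖ ^ k))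
      (hg1.add hg0) fun k => ?_
    rw [norm_mul, norm_pow, pow_one]
    calc ‖eulerCoeffTwo l m k‖ * ‖z‖ ^ k ≤ ((k : ℝ) + 1) * ‖z‖ ^ k := by
          gcongr
          exact norm_eulerCoeffTwo_le hl hm k
      _ = (k : ℝ) * ‖z‖ ^ k + ‖z‖ ^ k := by ring
  have key := tsum_mul_eq_one_of_recurrence'' (x := z) (a := l + m) (b := l * m)
    (c := fun k => eulerCoeffTwo l m k) (eulerCoeffTwo_zero l m) (eulerCoeffTwo_one l m)
    (eulerCoeffTwo_add_two l m) hsum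
  have hE : (1 - l * z) * (1 - m * z) = 1 - (l + m) * z + l * m * z ^ 2 := by ring
  rw [hE, ← eq_inv_of_mul_eq_one_left key]
  exact hsum.hasSum

/-! ### The Dirichlet coefficients of `L(s, ρ)`, `dim V ≤ 2`, with their local generating series -/

section Local

variable {V : Type*} [AddCommGroup V] [Module ℂ V] [TopologicalSpace V] [FiniteDimensional ℂ V]
  [IsModuleTopology ℂ V]

/-- **The Dirichlet coefficients of `L(s, ρ)` and their local generating series.**  For an Artin
representation `ρ : Γ_ℚ → GL(V)` with `dim V ≤ 2` there is `a : ℕ → ℂ` with `a 0 = 0`, `a 1 = 1`,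
`a(mn) = a(m) a(n)` for coprime `m, n`, `|a(n)| ≤ d(n)`, `∑ a(n) n^{-s} = L(s, ρ)` absolutely
convergent on `Re s > 1`, AND, for every prime `p` and every `|z| < 1`,
`∑_k a(p^k) z^k = 1 / L_p(ρ, z)` where `L_p(ρ, T) = det(1 - T ρ(Frob_p) | V^{I_p})` is the Euler
factor at the place of `ℚ` over `p` (`ArtinRep.eulerFactorAt`, `Rat.HeightOneSpectrum.primesEquiv`).
This is the construction of `ArtinRep.exists_LSeries_eq_artinLFunction_of_finrank_le_two`
(`a(p^k) = h_k(λ_p, μ_p)` for the zero-padded inverse roots of `L_p(ρ, T) = (1 - λ_p T)(1 - μ_p T)`),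
re-run so as to expose the local clause (`hasSum_eulerCoeffTwo_mul_pow`).
[cite: DeligneSerreASENS1974, §9 Thm. 9.1 and Cor. 9.2] -/
theorem ArtinRep.exists_LSeries_eq_artinLFunction_local (ρ : ArtinRep ℚ V)
    (hV : finrank ℂ V ≤ 2) :
    ∃ a : ℕ → ℂ, a 0 = 0 ∧ a 1 = 1 ∧ (∀ m n : ℕ, m.Coprime n → a (m * n) = a m * a n) ∧
      (∀ n : ℕ, ‖a n‖ ≤ (n.divisors.card : ℝ)) ∧
      (∀ s : ℂ, 1 < s.re → LSeriesSummable a s ∧ LSeries a s = artinLFunction ρ s) ∧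
      ∀ (p : Nat.Primes) (z : ℂ), ‖z‖ < 1 →
        HasSum (fun k : ℕ => a ((p : ℕ) ^ k) * z ^ k)
          ((ρ.eulerFactorAt ((primesEquiv (R := 𝓞 ℚ)).symm p)).eval z)⁻¹ := by
  have hfin : (Set.range (ρ : absoluteGaloisGroup ℚ → V →ₗ[ℂ] V)).Finite :=
    ArtinRep.finite_range_holds ρ
  -- local data: the padded inverse roots at the place over each prime
  have hloc : ∀ p : Nat.Primes, ∃ lm : ℂ × ℂ, ‖lm.1‖ ≤ 1 ∧ ‖lm.2‖ ≤ 1 ∧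
      ∀ z : ℂ, (ρ.eulerFactorAt ((primesEquiv (R := 𝓞 ℚ)).symm p)).eval z =
        (1 - lm.1 * z) * (1 - lm.2 * z) := by
    intro p
    obtain ⟨B, hcard, hnorm, heval⟩ := ρ.exists_card_le_eval_eulerFactorAt_eq_prod hfin
      ((primesEquiv (R := 𝓞 ℚ)).symm p)
    obtain ⟨l, m, hl, hm, hlm⟩ := exists_pair_of_card_le_two (hcard.trans hV) hnorm
    exact ⟨(l, m), hl, hm, fun z => by rw [heval, hlm]⟩
  choose lm hl hm hfac using hloc
  -- the coefficients on prime powers and their multiplicative extension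
  let c : ℕ → ℕ → ℂ := fun p k =>
    if hp : p.Prime then eulerCoeffTwo (lm ⟨p, hp⟩).1 (lm ⟨p, hp⟩).2 k else 1
  have hcp : ∀ {p : ℕ} (hp : p.Prime) (k : ℕ),
      c p k = eulerCoeffTwo (lm ⟨p, hp⟩).1 (lm ⟨p, hp⟩).2 k := fun hp k => by
    simp only [c, dif_pos hp]
  have hc0 : ∀ p, c p 0 = 1 := fun p => by
    by_cases hp : p.Prime
    · rw [hcp hp, eulerCoeffTwo_zero]
    · simp only [c, dif_neg hp]
  set a : ℕ → ℂ := multiplicativeExtension c with ha_def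
  have ha1 : a 1 = 1 := multiplicativeExtension_one c
  have hamul : ∀ m n : ℕ, m.Coprime n → a (m * n) = a m * a n := fun m n hmn =>
    multiplicativeExtension_mul_of_coprime c hmn
  have happ : ∀ {p : ℕ} (hp : p.Prime) (k : ℕ),
      a (p ^ k) = eulerCoeffTwo (lm ⟨p, hp⟩).1 (lm ⟨p, hp⟩).2 k := fun hp k => by
    rw [ha_def, multiplicativeExtension_prime_pow c hp (hc0 _), hcp hp]
  have hnorm : ∀ n, ‖a n‖ ≤ (n.divisors.card : ℝ) :=
    norm_multiplicativeExtension_le_card_divisors c (fun p hp k => by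
      rw [hcp hp]
      exact norm_eulerCoeffTwo_le (hl ⟨p, hp⟩) (hm ⟨p, hp⟩) k)
  -- the local generating series
  have hlocal : ∀ (p : Nat.Primes) (z : ℂ), ‖z‖ < 1 →
      HasSum (fun k : ℕ => a ((p : ℕ) ^ k) * z ^ k)
        ((ρ.eulerFactorAt ((primesEquiv (R := 𝓞 ℚ)).symm p)).eval z)⁻¹ := by
    intro p z hz
    have hp : (p : ℕ).Prime := p.2
    have heq : (fun k : ℕ => a ((p : ℕ) ^ k) * z ^ k) =
        fun k : ℕ => eulerCoeffTwo (lm p).1 (lm p).2 k * z ^ k := by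
      funext k
      rw [happ hp, Subtype.coe_eta]
    rw [heq, hfac p z]
    exact hasSum_eulerCoeffTwo_mul_pow (hl p) (hm p) hz
  refine ⟨a, multiplicativeExtension_zero c, ha1, hamul, hnorm, fun s hs => ?_, hlocal⟩
  have hsum : LSeriesSummable a s := lseriesSummable_of_norm_le_card_divisors hnorm hs
  refine ⟨hsum, ?_⟩
  -- the Euler product of `∑ a(n) n^{-s}` (Mathlib), with the local factors `1 / L_p(ρ, p^{-s})`
  set G : ℕ → ℂ := LSeries.term a s with hG
  have hGn : ∀ {n : ℕ}, n ≠ 0 → G n = a n * (n : ℂ) ^ (-s) := fun hn ↦ by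
    rw [hG, LSeries.term_of_ne_zero hn, div_eq_mul_inv, ← cpow_neg]
  have hG0 : G 0 = 0 := LSeries.term_zero a s
  have hG1 : G 1 = 1 := by rw [hGn one_ne_zero, ha1, Nat.cast_one, one_cpow, mul_one]
  have hGmul : ∀ {m n : ℕ}, m.Coprime n → G (m * n) = G m * G n := by
    intro m n hmn
    rcases eq_or_ne m 0 with rfl | hm0
    · rw [zero_mul, hG0, zero_mul]
    rcases eq_or_ne n 0 with rfl | hn0
    · rw [mul_zero, hG0, mul_zero]
    rw [hGn (mul_ne_zero hm0 hn0), hGn hm0, hGn hn0, hamul m n hmn, Nat.cast_mul,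
      natCast_mul_natCast_cpow]
    ring
  have hsumG : Summable fun n ↦ ‖G n‖ := summable_norm_iff.mpr hsum
  have hEP := EulerProduct.eulerProduct_hasProd hG1 hGmul hsumG hG0
  have hfactor : ∀ p : Nat.Primes, ∑' r : ℕ, G ((p : ℕ) ^ r) =
      ((ρ.eulerFactorAt ((primesEquiv (R := 𝓞 ℚ)).symm p)).eval ((p : ℂ) ^ (-s)))⁻¹ := by
    intro p
    have hp : (p : ℕ).Prime := p.2
    have hGp : ∀ r : ℕ, G ((p : ℕ) ^ r) = a ((p : ℕ) ^ r) * ((p : ℂ) ^ (-s)) ^ r := fun r ↦ by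
      rw [hGn (pow_ne_zero _ hp.ne_zero), Nat.cast_pow, ← natCast_cpow_natCast_mul,
        ← cpow_nat_mul]
    have hz : ‖(p : ℂ) ^ (-s)‖ < 1 := by
      rw [norm_natCast_cpow_of_pos hp.pos, Real.rpow_lt_one_iff_of_pos (by exact_mod_cast hp.pos)]
      left
      refine ⟨by exact_mod_cast hp.one_lt, ?_⟩
      rw [neg_re]
      linarith
    simp_rw [hGp]
    exact (hlocal p _ hz).tsum_eq
  -- transport to the finite places of `ℚ`
  have hF : HasProd (fun v : HeightOneSpectrum (𝓞 ℚ) =>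
      ((ρ.eulerFactorAt v).eval ((v.residueCard : ℂ) ^ (-s)))⁻¹) (LSeries a s) := by
    rw [← Equiv.hasProd_iff (primesEquiv (R := 𝓞 ℚ)).symm]
    have heq : ((fun v : HeightOneSpectrum (𝓞 ℚ) =>
        ((ρ.eulerFactorAt v).eval ((v.residueCard : ℂ) ^ (-s)))⁻¹) ∘
          (primesEquiv (R := 𝓞 ℚ)).symm) =
        fun p : Nat.Primes => ∑' r : ℕ, G ((p : ℕ) ^ r) := by
      funext p
      simp only [Function.comp_apply]
      rw [hfactor p, FramedRep.residueCard_eq_coe_primesEquiv', Equiv.apply_symm_apply]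
    rw [heq]
    exact hEP
  exact hF.tprod_eq.symm

end Local

/-! ### Any coefficient sequence of `L(s, σ)`, `σ : Γ_ℚ → GL₂(ℂ)` -/

namespace FramedArtinRep

/-- **Local generating series of the Dirichlet coefficients of `L(s, σ)`.**  If `a : ℕ → ℂ` is
any sequence with `∑ a(n) n^{-s} = L(s, σ)` on `Re s > 1` (`σ : Γ_ℚ → GL₂(ℂ)`), then for every
prime `p` and `|z| < 1`, `∑_k a(p^k) z^k = 1 / L_p(σ, z)`: `a` agrees on `n ≥ 1` with the sequence
of `ArtinRep.exists_LSeries_eq_artinLFunction_local` (both Dirichlet series converge absolutely on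
`Re s > 1` — `L(s, σ) ≠ 0` there, `artinLFunction_ne_zero_of_one_lt_re` — and have the same sum;
Mathlib `LSeries.eq_of_LSeries_eventually_eq`). [cite: DeligneSerreASENS1974, §9 Thm. 9.1 and Cor. 9.2] -/
theorem hasSum_coeff_prime_pow (σ : FramedArtinRep ℚ 2) {a : ℕ → ℂ}
    (ha : ∀ s : ℂ, 1 < s.re → LSeries a s = artinLFunction σ.toArtinRep s) (p : Nat.Primes)
    {z : ℂ} (hz : ‖z‖ < 1) :
    HasSum (fun k : ℕ => a ((p : ℕ) ^ k) * z ^ k)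
      ((σ.toArtinRep.eulerFactorAt ((primesEquiv (R := 𝓞 ℚ)).symm p)).eval z)⁻¹ := by
  obtain ⟨b, -, -, -, -, hbL, hbloc⟩ :=
    σ.toArtinRep.exists_LSeries_eq_artinLFunction_local (by rw [Module.finrank_fin_fun])
  -- `a` is absolutely summable on `re s > 1` since `L(s, σ) ≠ 0` there
  have hasum : ∀ s : ℂ, 1 < s.re → LSeriesSummable a s := by
    intro s hs
    by_contra h
    have h0 : LSeries a s = 0 := tsum_eq_zero_of_not_summable h
    exact artinLFunction_ne_zero_of_one_lt_re σ.toArtinRep hs ((ha s hs).symm.trans h0)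
  have habs : ∀ f : ℕ → ℂ, (∀ s : ℂ, 1 < s.re → LSeriesSummable f s) →
      LSeries.abscissaOfAbsConv f < ⊤ := by
    intro f hf
    refine lt_of_le_of_lt (LSeries.abscissaOfAbsConv_le_of_forall_lt_LSeriesSummable
      (x := 1) fun y hy => hf y ?_) (EReal.coe_lt_top 1)
    simpa using hy
  have hev : (fun x : ℝ => LSeries a x) =ᶠ[atTop] fun x => LSeries b x := by
    filter_upwards [eventually_gt_atTop (1 : ℝ)] with x hx
    have hx' : 1 < (x : ℂ).re := by simpa using hx
    rw [ha x hx', (hbL x hx').2]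
  have hab : ∀ n : ℕ, n ≠ 0 → a n = b n := fun n hn =>
    LSeries.eq_of_LSeries_eventually_eq (habs a hasum) (habs b fun s hs => (hbL s hs).1) hev hn
  have heq : (fun k : ℕ => a ((p : ℕ) ^ k) * z ^ k) = fun k : ℕ => b ((p : ℕ) ^ k) * z ^ k := by
    funext k
    rw [hab _ (pow_ne_zero _ p.2.ne_zero)]
  rw [heq]
  exact hbloc p z hz

/-- Absolute convergence passes to character twists (`|ε(n)| ≤ 1`,
Mathlib `DirichletCharacter.norm_le_one`; the tree's `LSeries.lseriesSummable_mul_dirichlet` of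
`LFunctions/AdditiveTwistProofs`, re-proved to keep this file inside the Galois-representations
topic). [folklore] -/
theorem lseriesSummable_mul_dirichlet' {a : ℕ → ℂ} {s : ℂ} (h : LSeriesSummable a s) {N : ℕ}
    (ε : DirichletCharacter ℂ N) : LSeriesSummable (fun n : ℕ => a n * ε (n : ZMod N)) s := by
  refine Summable.of_norm_bounded (g := fun n => ‖LSeries.term a s n‖) h.norm (fun n => ?_)
  rcases eq_or_ne n 0 with rfl | hn
  · simp [LSeries.term_zero]
  · rw [LSeries.term_of_ne_zero hn, LSeries.term_of_ne_zero hn, norm_div, norm_div, norm_mul]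
    have h1 := DirichletCharacter.norm_le_one ε (n : ZMod N)
    have h2 : 0 ≤ ‖a n‖ := norm_nonneg _
    calc ‖a n‖ * ‖ε (n : ZMod N)‖ / ‖(n : ℂ) ^ s‖ ≤ ‖a n‖ * 1 / ‖(n : ℂ) ^ s‖ := by gcongr
      _ = ‖a n‖ / ‖(n : ℂ) ^ s‖ := by rw [mul_one]

/-- The finitely many Euler factors at the primes dividing `N` give an entire function
`C(s) = ∏_{p ∣ N} L_p(π, p^{-s})` (polynomials in `p^{-s}`). [folklore] -/
theorem differentiable_prod_eval_eulerFactorAt {n : ℕ} (π : FramedArtinRep ℚ n)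
    (T : Finset Nat.Primes) :
    Differentiable ℂ fun s : ℂ => ∏ p ∈ T,
      (π.toArtinRep.eulerFactorAt ((primesEquiv (R := 𝓞 ℚ)).symm p)).eval ((p : ℂ) ^ (-s)) := by
  have h : ∀ p ∈ T, Differentiable ℂ fun s : ℂ =>
      (π.toArtinRep.eulerFactorAt ((primesEquiv (R := 𝓞 ℚ)).symm p)).eval ((p : ℂ) ^ (-s)) :=
    fun p _ => by
      change Differentiable ℂ
        ((fun z : ℂ => (π.toArtinRep.eulerFactorAt ((primesEquiv (R := 𝓞 ℚ)).symm p)).eval z) ∘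
          fun s : ℂ => (p : ℂ) ^ (-s))
      exact (Polynomial.differentiable _).comp
        (differentiable_id.neg.const_cpow (Or.inl (Nat.cast_ne_zero.mpr p.2.ne_zero)))
  exact Differentiable.fun_finsetProd h

variable {N : ℕ} [NeZero N]

/-- **The naive character twist of the Dirichlet series of `L(s, σ)` is `L(s, σ ⊗ ε)` up to the
Euler factors at the primes dividing the level** (Booker 2003, proof of Lemma 1, p. 1093:
"`∑ a_r χ(r) r^{-s}` is `L(s, ρ ⊗ χ₀ ⊗ χ)`, with the Euler factor at `p` removed. That factor …
amount[s] to polynomials in `p^{-s}`").  Let `σ : Γ_ℚ → GL₂(ℂ)` be an Artin representation, `ε` a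
Dirichlet character mod `N ≥ 1` (of any conductor), and `π` the twist of `σ` by the Galois
character of `ε` (`π(g) = ε(χ_N(g)) · σ(g)`).  Then there is an entire function `C` — namely
`C(s) = ∏_{p ∣ N} L_p(π, p^{-s})` — such that for EVERY `a : ℕ → ℂ` with
`∑ a(n) n^{-s} = L(s, σ)` on `Re s > 1` and every `s` with `Re s > 1`,
`∑_n a(n) ε(n) n^{-s} = C(s) · L(s, π)`.
Proof: Euler product of the multiplicative sequence `a · ε` (Mathlib
`EulerProduct.eulerProduct_hasProd`) with local factors `∑_k a(p^k) (ε(p) p^{-s})^k =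
1 / L_p(σ, ε(p) p^{-s})` (`hasSum_coeff_prime_pow`), equal to `1 / L_p(π, p^{-s})` for `p ∤ N`
(`FramedRep.eval_eulerFactorAt_of_twist_dirichlet`) and to `1` for `p ∣ N`; comparison with the
Euler product of `π` (`artinLFunction_eulerProduct_holds`, reindexed by
`Rat.HeightOneSpectrum.primesEquiv`). [cite: Booker2003, proof of Lemma 1 p. 1093] -/
theorem exists_entire_LSeries_mul_dirichlet_eq (σ π : FramedArtinRep ℚ 2) (ε : DirichletCharacter ℂ N)
    (hπ : ∀ g, π g = Matrix.GeneralLinearGroup.scalar (Fin 2) (dirichletGaloisCharacter ℚ ε g) * σ g) :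
    ∃ C : ℂ → ℂ, Differentiable ℂ C ∧
      ∀ (a : ℕ → ℂ), (∀ s : ℂ, 1 < s.re → LSeries a s = artinLFunction σ.toArtinRep s) →
        ∀ s : ℂ, 1 < s.re →
          LSeries (fun n : ℕ => a n * ε (n : ZMod N)) s = C s * artinLFunction π.toArtinRep s := by
  classical
  -- the finite set of primes dividing `N` and the correction factor
  have hTfin : ((fun p : Nat.Primes => (p : ℕ)) ⁻¹' (↑N.primeFactors : Set ℕ)).Finite :=
    N.primeFactors.finite_toSet.preimage Nat.Primes.coe_nat_injective.injOn
  set T : Finset Nat.Primes := hTfin.toFinset with hT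
  have hmemT : ∀ p : Nat.Primes, p ∈ T ↔ (p : ℕ) ∣ N := fun p => by
    rw [hT, Set.Finite.mem_toFinset, Set.mem_preimage, Finset.mem_coe,
      Nat.mem_primeFactors_of_ne_zero (NeZero.ne N)]
    exact ⟨fun h => h.2, fun h => ⟨p.2, h⟩⟩
  set C : ℂ → ℂ := fun s => ∏ p ∈ T,
    (π.toArtinRep.eulerFactorAt ((primesEquiv (R := 𝓞 ℚ)).symm p)).eval ((p : ℂ) ^ (-s)) with hC
  refine ⟨C, differentiable_prod_eval_eulerFactorAt π T, fun a ha s hs => ?_⟩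
  -- replace `a` by the normalised multiplicative coefficient sequence `b`
  obtain ⟨b, hb0, hb1, hbmul, -, hab, hbsum⟩ := σ.eq_of_LSeries_eq_artinLFunction_two ha
  have hbL : ∀ s : ℂ, 1 < s.re → LSeries b s = artinLFunction σ.toArtinRep s :=
    fun s hs => (hbsum s hs).2.2
  have hLab : LSeries (fun n : ℕ => a n * ε (n : ZMod N)) s =
      LSeries (fun n : ℕ => b n * ε (n : ZMod N)) s :=
    LSeries_congr (fun {n} hn => by simp only [hab n hn]) s
  rw [hLab]
  -- Euler product of the multiplicative sequence `b · ε`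
  set f : ℕ → ℂ := fun n => b n * ε (n : ZMod N) with hf
  set G : ℕ → ℂ := LSeries.term f s with hG
  have hGn : ∀ {n : ℕ}, n ≠ 0 → G n = b n * ε (n : ZMod N) * (n : ℂ) ^ (-s) := fun hn ↦ by
    rw [hG, LSeries.term_of_ne_zero hn, div_eq_mul_inv, ← cpow_neg]
  have hG0 : G 0 = 0 := LSeries.term_zero f s
  have hG1 : G 1 = 1 := by
    rw [hGn one_ne_zero, hb1, Nat.cast_one, Nat.cast_one, map_one, one_cpow, mul_one, mul_one]
  have hGmul : ∀ {m n : ℕ}, m.Coprime n → G (m * n) = G m * G n := by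
    intro m n hmn
    rcases eq_or_ne m 0 with rfl | hm0
    · rw [zero_mul, hG0, zero_mul]
    rcases eq_or_ne n 0 with rfl | hn0
    · rw [mul_zero, hG0, mul_zero]
    rw [hGn (mul_ne_zero hm0 hn0), hGn hm0, hGn hn0, hbmul m n hmn, Nat.cast_mul, Nat.cast_mul,
      map_mul, natCast_mul_natCast_cpow]
    ring
  have hsumG : Summable fun n ↦ ‖G n‖ :=
    summable_norm_iff.mpr (lseriesSummable_mul_dirichlet' (hbsum s hs).2.1 ε)
  have hEP := EulerProduct.eulerProduct_hasProd hG1 hGmul hsumG hG0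
  -- the local factors of `b · ε`
  have hfactor : ∀ p : Nat.Primes, ∑' r : ℕ, G ((p : ℕ) ^ r) =
      ((σ.toArtinRep.eulerFactorAt ((primesEquiv (R := 𝓞 ℚ)).symm p)).eval
        (ε ((p : ℕ) : ZMod N) * (p : ℂ) ^ (-s)))⁻¹ := by
    intro p
    have hp : (p : ℕ).Prime := p.2
    have hGp : ∀ r : ℕ, G ((p : ℕ) ^ r) =
        b ((p : ℕ) ^ r) * (ε ((p : ℕ) : ZMod N) * (p : ℂ) ^ (-s)) ^ r := fun r ↦ by
      rw [hGn (pow_ne_zero _ hp.ne_zero), Nat.cast_pow, Nat.cast_pow, map_pow, mul_pow,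
        ← cpow_nat_mul, ← natCast_cpow_natCast_mul]
      ring
    have hz : ‖ε ((p : ℕ) : ZMod N) * (p : ℂ) ^ (-s)‖ < 1 := by
      rw [norm_mul]
      have h1 := DirichletCharacter.norm_le_one ε ((p : ℕ) : ZMod N)
      have h2 : ‖(p : ℂ) ^ (-s)‖ < 1 := by
        rw [norm_natCast_cpow_of_pos hp.pos,
          Real.rpow_lt_one_iff_of_pos (by exact_mod_cast hp.pos)]
        left
        refine ⟨by exact_mod_cast hp.one_lt, ?_⟩
        rw [neg_re]
        linarith
      calc ‖ε ((p : ℕ) : ZMod N)‖ * ‖(p : ℂ) ^ (-s)‖ ≤ 1 * ‖(p : ℂ) ^ (-s)‖ := by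
            gcongr
        _ < 1 := by rw [one_mul]; exact h2
    simp_rw [hGp]
    exact (σ.hasSum_coeff_prime_pow hbL p hz).tsum_eq
  -- the Euler factors of `π` and the correction terms at `p ∣ N`
  set g : Nat.Primes → ℂ := fun p =>
    ((π.toArtinRep.eulerFactorAt ((primesEquiv (R := 𝓞 ℚ)).symm p)).eval ((p : ℂ) ^ (-s)))⁻¹
    with hg
  set c : Nat.Primes → ℂ := fun p => if (p : ℕ) ∣ N then
    (π.toArtinRep.eulerFactorAt ((primesEquiv (R := 𝓞 ℚ)).symm p)).eval ((p : ℂ) ^ (-s)) else 1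
    with hc
  have hne : ∀ p : Nat.Primes,
      (π.toArtinRep.eulerFactorAt ((primesEquiv (R := 𝓞 ℚ)).symm p)).eval ((p : ℂ) ^ (-s)) ≠ 0 := by
    intro p
    have h := π.toArtinRep.eval_eulerFactorAt_ne_zero ((primesEquiv (R := 𝓞 ℚ)).symm p)
      (s := s) (by linarith)
    rwa [FramedRep.residueCard_eq_coe_primesEquiv', Equiv.apply_symm_apply] at h
  have hlocal : ∀ p : Nat.Primes, ∑' r : ℕ, G ((p : ℕ) ^ r) = g p * c p := by
    intro p
    rw [hfactor p]
    by_cases hpN : (p : ℕ) ∣ N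
    · -- `ε(p) = 0`: the local factor is `1 = L_p(π, p^{-s})⁻¹ · L_p(π, p^{-s})`
      have hε0 : ε ((p : ℕ) : ZMod N) = 0 := by
        apply MulChar.map_nonunit
        rw [ZMod.isUnit_iff_coprime]
        intro hcop
        exact p.2.one_lt.ne' (Nat.Coprime.eq_one_of_dvd hcop hpN)
      rw [hε0, zero_mul, ← Polynomial.coeff_zero_eq_eval_zero, ArtinRep.eulerFactorAt_coeff_zero,
        inv_one]
      simp only [hg, hc, if_pos hpN]
      exact (inv_mul_cancel₀ (hne p)).symm
    · simp only [hg, hc, if_neg hpN, mul_one]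
      rw [FramedRep.eval_eulerFactorAt_of_twist_dirichlet ε hπ (v := (primesEquiv (R := 𝓞 ℚ)).symm p)
        (by rwa [Equiv.apply_symm_apply]), Equiv.apply_symm_apply]
  -- the Euler product of `π`, over the primes
  have hπEP : HasProd g (artinLFunction π.toArtinRep s) := by
    have h := artinLFunction_eulerProduct_holds π.toArtinRep hs
    rw [← Equiv.hasProd_iff (primesEquiv (R := 𝓞 ℚ)).symm] at h
    convert h using 1
    funext p
    simp only [Function.comp_apply, hg]
    rw [FramedRep.residueCard_eq_coe_primesEquiv', Equiv.apply_symm_apply]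
  -- the correction factor, a finite product
  have hcEP : HasProd c (C s) := by
    have hC' : C s = ∏ p ∈ T, c p := by
      simp only [hC, hc]
      exact Finset.prod_congr rfl fun p hp => by rw [if_pos ((hmemT p).mp hp)]
    rw [hC']
    refine hasProd_prod_of_ne_finset_one fun p hp => ?_
    simp only [hc, if_neg (fun h => hp ((hmemT p).mpr h))]
  have hprod : HasProd (fun p => g p * c p) (artinLFunction π.toArtinRep s * C s) := hπEP.mul hcEP
  have hEP' : HasProd (fun p => g p * c p) (LSeries f s) := by
    have heq : (fun p : Nat.Primes => ∑' r : ℕ, G ((p : ℕ) ^ r)) = fun p => g p * c p :=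
      funext hlocal
    rw [← heq]
    exact hEP
  rw [mul_comm]
  exact hEP'.unique hprod

end FramedArtinRep

end Literature.NumberTheory.GaloisRepresentations

end
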